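import Mathlib.AlgebraicGeometry.IdealSheaf.Basic
import Mathlib.AlgebraicGeometry.AffineScheme
import Mathlib.RingTheory.Spectrum.Prime.Topology
import HarnessLib

/-!
# The vanishing ideal sheaf of a closed point, evaluated on affine opens

Support file for crux stmt-ResolutionOfSingularities-15315
(`FrobeniusLadder.FInjectiveMacaulayfication`, line `Sketch`, seat c5): stub
`stub_vanishingIdealPointIdeal`.

For a closed point `y₀` of a scheme `X`, the ideal sheaf `J = vanishingIdeal {y₀}` is the centre
of the second blow-up of the char-3 tower; the crux's blow-up engine needs its sections
`J.ideal U` on the affine opens `U` of a cover. They are: the unit ideal when `y₀ ∉ U`, and the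
prime `primeIdealOf y₀` of `Γ(X, U)` when `y₀ ∈ U`.

Proof: by definition `(vanishingIdeal Z).ideal U = PrimeSpectrum.vanishingIdeal (fromSpec ⁻¹' Z)`
for the canonical open immersion `fromSpec : Spec Γ(X, U) ⟶ X` with range `U`. If `y₀ ∉ U` the
preimage of `{y₀}` is empty and the vanishing ideal of `∅` is `⊤`. If `y₀ ∈ U` the preimage is
the singleton `{primeIdealOf y₀}` (it contains this prime as `fromSpec (primeIdealOf y₀) = y₀`,
and nothing else since `fromSpec` is injective), and the vanishing ideal of `{q}` is `q`.

References: folklore bookkeeping over Mathlib's `AlgebraicGeometry.IdealSheaf` API (the reduced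
induced closed-subscheme structure on a closed point, cf. The Stacks Project, Tag 01J3);
no definition is declared. [folklore]
-/

-- single-problem summit: the doubled namespace component `ResolutionOfSingularities` is forced
set_option linter.dupNamespace false

noncomputable section

namespace Summit.ResolutionOfSingularities.ResolutionOfSingularities.Theorems.FInjectiveMacaulayfication.VanishingIdealPoint

open AlgebraicGeometry CategoryTheory TopologicalSpace

/-- For an affine open `U` of a scheme `X` and a point `y₀ ∈ U`, the preimage of `{y₀}` under the
canonical open immersion `fromSpec : Spec Γ(X, U) ⟶ X` is the singleton `{primeIdealOf y₀}`.
[folklore] -/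
theorem fromSpec_preimage_singleton {X : Scheme.{0}} {U : X.Opens} (hU : IsAffineOpen U)
    (y₀ : X) (h : y₀ ∈ U) :
    hU.fromSpec ⁻¹' ({y₀} : Set X) = {hU.primeIdealOf ⟨y₀, h⟩} := by
  ext q
  simp only [Set.mem_preimage, Set.mem_singleton_iff]
  constructor
  · intro hq
    apply hU.fromSpec.isOpenEmbedding.injective
    rw [hq, hU.fromSpec_primeIdealOf]
  · rintro rfl
    exact hU.fromSpec_primeIdealOf ⟨y₀, h⟩

/-- For an affine open `U` of a scheme `X` and a point `y₀ ∉ U`, the preimage of `{y₀}` under the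
canonical open immersion `fromSpec : Spec Γ(X, U) ⟶ X` (whose range is `U`) is empty.
[folklore] -/
theorem fromSpec_preimage_singleton_eq_empty {X : Scheme.{0}} {U : X.Opens} (hU : IsAffineOpen U)
    (y₀ : X) (h : y₀ ∉ U) :
    hU.fromSpec ⁻¹' ({y₀} : Set X) = ∅ := by
  ext q
  simp only [Set.mem_preimage, Set.mem_singleton_iff, Set.mem_empty_iff_false, iff_false]
  intro hq
  apply h
  rw [← hq, ← SetLike.mem_coe, ← hU.range_fromSpec]
  exact Set.mem_range_self q

/-- **The vanishing ideal sheaf of a closed point on affine opens.** Let `y₀` be a closed point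
of a scheme `X` and `J = vanishingIdeal {y₀}` its ideal sheaf. For every affine open `U` of
`X`: if `y₀ ∉ U` then `J(U) = ⊤`, and if `y₀ ∈ U` then `J(U)` is the prime ideal
`primeIdealOf y₀` of `Γ(X, U)` corresponding to `y₀`.
[folklore] -/
theorem stub_vanishingIdealPointIdeal : ∀ (X : Scheme.{0}) (y₀ : X) (hy : IsClosed ({y₀} : Set X))
    (U : X.affineOpens),
    (y₀ ∉ (U : X.Opens) → (Scheme.IdealSheafData.vanishingIdeal ⟨{y₀}, hy⟩).ideal U = ⊤) ∧
    (∀ h : y₀ ∈ (U : X.Opens),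
      (Scheme.IdealSheafData.vanishingIdeal ⟨{y₀}, hy⟩).ideal U = (U.2.primeIdealOf ⟨y₀, h⟩).asIdeal) := by
  intro X y₀ hy U
  refine ⟨fun h => ?_, fun h => ?_⟩
  · rw [Scheme.IdealSheafData.vanishingIdeal_ideal]
    exact PrimeSpectrum.vanishingIdeal_eq_top_iff.mpr (fromSpec_preimage_singleton_eq_empty U.2 y₀ h)
  · rw [Scheme.IdealSheafData.vanishingIdeal_ideal]
    exact (congrArg PrimeSpectrum.vanishingIdeal (fromSpec_preimage_singleton U.2 y₀ h)).trans
      (PrimeSpectrum.vanishingIdeal_singleton _)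

end Summit.ResolutionOfSingularities.ResolutionOfSingularities.Theorems.FInjectiveMacaulayfication.VanishingIdealPoint

end
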